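import Mathlib.FieldTheory.KummerPolynomial
import Mathlib.FieldTheory.Galois.Infinite
import Mathlib.FieldTheory.Galois.Profinite
import Mathlib.FieldTheory.Minpoly.Field
import Mathlib.FieldTheory.IsAlgClosed.AlgebraicClosure
import Mathlib.NumberTheory.Padics.PadicNumbers
import Mathlib.Topology.Algebra.Group.Basic
import HarnessLib

/-!
# The absolute Galois group of `ℚ_p` — and of every finite extension of `ℚ_p` — is infinite

Classical facts, proved here from Mathlib alone (no definition, no named fact):

* `infinite_algEquiv_of_irreducible_unbounded` — if `Ω/k` is Galois with `Ω` algebraically closed and `k`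
  has irreducible polynomials of arbitrarily large degree, then `Gal(Ω/k) = Ω ≃ₐ[k] Ω` is infinite
  (a finite Hausdorff Galois group is discrete, so the trivial subgroup `= Gal(Ω/Ω)` is open, so `Ω/k` is
  finite-dimensional by the fundamental theorem of infinite Galois theory — contradicting
  `deg (minpoly k α) ≤ [Ω : k]` for a root `α` of an irreducible polynomial of larger degree);
* `Padic.irreducible_X_pow_sub_C_natCast` — `X ^ ℓ − p` is irreducible over `ℚ_p` for every prime `ℓ`
  (`p` has valuation `1`, so it is not an `ℓ`-th power; Mathlib's `X_pow_sub_C_irreducible_of_prime`);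
* `Padic.infinite_algEquiv_algebraicClosure` — `G_{ℚ_p} := Gal(ℚ̄_p/ℚ_p)` is infinite, `ℚ̄_p := AlgebraicClosure ℚ_[p]`;
* `Subgroup.infinite_of_isOpen_of_compactSpace` — an open subgroup of an infinite compact Hausdorff
  topological group is infinite (else `{1}` would be open and the group discrete, hence finite);
* `Padic.infinite_fixingSubgroup` — for `K ⊆ ℚ̄_p` finite over `ℚ_p`, the closed subgroup
  `G_K = Gal(ℚ̄_p/K) = K.fixingSubgroup` is infinite.

* `Padic.not_finiteDimensional_algebraicClosure` — Gouvêa's Cor. 6.3.10 verbatim: "the algebraic closure `ℚ̄_p`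
  is an infinite extension of `ℚ_p`".

Sources.  F. Q. Gouvêa, *p-adic Numbers: An Introduction* (Universitext; held render = 3rd ed.,
lit `book:gouvea1993-p-adic-numbers`, pp. p0162–p0163): Prop. 6.3.11 (Eisenstein irreducibility criterion
over `ℚ_p`), Cor. 6.3.10 ("`ℚ̄_p` is an infinite extension of `ℚ_p`").  J. S. Milne, *Fields and Galois
Theory* v5.10: Thm. 3.4 (Artin), Thm. 7.13 (b) (a closed subgroup of `Gal(Ω/F)` is open iff its fixed
field is finite over `F`), Ch. 7 p. 102 ("as `G` is compact, each open `U` has finite index").  Our proofs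
go through Mathlib's infinite Galois theory (`InfiniteGalois.isOpen_iff_finite`) and Kummer polynomials
(`X_pow_sub_C_irreducible_of_prime`) rather than Gauss's lemma.

Consumers (abc-iut cell): the `[Infinite G_k]` / `[CompactSpace G_k]` binders of
`Literature.IUT.HodgeTheaters.StableCurveTemperedData.cor25_byName` ([IUTchI] Cor. 2.5) at the genuine
`G_K = K.fixingSubgroup ≤ Gal(ℚ̄_p/ℚ_p)` of the `[SemiAnbd]` §6 interface
`Literature.AnabelianGeometry.SemiGraphs.TemperedCurve`.  NOT here: ramification theory, the structure of
`G_{ℚ_p}`.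
-/

open Polynomial

namespace Literature.NumberTheory.LocalFields

universe u v

/-! ### A general criterion -/

/-- The fixing subgroup of the bottom intermediate field is everything: every `k`-automorphism fixes `k`
(the trivial inclusion `F ⊆ Ω^{Gal(Ω/F)}`). [cite: MilneFT2022, Prop 7.9] -/
theorem fixingSubgroup_bot_eq_top (k : Type u) (Ω : Type v) [Field k] [Field Ω] [Algebra k Ω] :
    (⊥ : IntermediateField k Ω).fixingSubgroup = ⊤ := by
  refine top_unique fun σ _ => ?_
  rw [IntermediateField.mem_fixingSubgroup_iff]
  intro x hx
  obtain ⟨y, rfl⟩ := IntermediateField.mem_bot.mp hx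
  exact σ.commutes y

/-- A field over which there are irreducible polynomials of arbitrarily large degree has no
finite-dimensional algebraically closed extension (the minimal polynomial of a root `α ∈ Ω` of an
irreducible `f` is `f` up to a unit, and `deg (minpoly k α) ≤ [Ω : k]`).  This is the mechanism of
Gouvêa's Cor. 6.3.10. [cite: Gouvea1993PadicNumbers, Cor 6.3.10] -/
theorem not_finiteDimensional_of_irreducible_unbounded (k : Type u) (Ω : Type v) [Field k] [Field Ω]
    [Algebra k Ω] [IsAlgClosed Ω] (h : ∀ n : ℕ, ∃ f : k[X], Irreducible f ∧ n < f.natDegree) :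
    ¬ FiniteDimensional k Ω := by
  intro hfd
  obtain ⟨f, hf, hdeg⟩ := h (Module.finrank k Ω)
  have hf0 : f.degree ≠ 0 := by
    intro h0
    have := Polynomial.natDegree_eq_of_degree_eq_some
      (h0.trans (by rfl : (0 : WithBot ℕ) = ((0 : ℕ) : WithBot ℕ)))
    omega
  obtain ⟨α, hα⟩ := IsAlgClosed.exists_aeval_eq_zero Ω f hf0
  -- `minpoly k α = f * C (leadingCoeff f)⁻¹` has the same degree as `f`
  have hmin : f * C f.leadingCoeff⁻¹ = minpoly k α := minpoly.eq_of_irreducible hf hα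
  have hdegmin : (minpoly k α).natDegree = f.natDegree := by
    rw [← hmin, Polynomial.natDegree_mul_C]
    exact inv_ne_zero (Polynomial.leadingCoeff_ne_zero.mpr hf.ne_zero)
  have hle : (minpoly k α).natDegree ≤ Module.finrank k Ω := minpoly.natDegree_le α
  omega

/-- **Infinite Galois theory**: if `Gal(Ω/k)` is finite for a Galois extension `Ω/k`, then `Ω/k` is
finite-dimensional — the trivial subgroup `Gal(Ω/Ω)` is then open in the Krull topology, and open (closed)
subgroups cut out the finite subextensions. [cite: MilneFT2022, Thm 7.13 (b)] -/
theorem finiteDimensional_of_finite_algEquiv (k : Type u) (Ω : Type v) [Field k] [Field Ω] [Algebra k Ω]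
    [IsGalois k Ω] [Finite (Ω ≃ₐ[k] Ω)] : FiniteDimensional k Ω := by
  have htop : FiniteDimensional k (⊤ : IntermediateField k Ω) := by
    refine (InfiniteGalois.isOpen_iff_finite (⊤ : IntermediateField k Ω)).mp ?_
    change IsOpen ((⊤ : IntermediateField k Ω).fixingSubgroup : Set (Ω ≃ₐ[k] Ω))
    exact isOpen_discrete _
  exact LinearEquiv.finiteDimensional (IntermediateField.topEquiv (F := k) (E := Ω)).toLinearEquiv

/-- **Criterion.** Let `Ω/k` be Galois with `Ω` algebraically closed (i.e. `Ω` an algebraic closure of the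
perfect field `k`). If `k` has irreducible polynomials of arbitrarily large degree, then the absolute Galois
group `Gal(Ω/k)` is infinite. [cite: MilneFT2022, Thm 7.13 (b)] -/
theorem infinite_algEquiv_of_irreducible_unbounded (k : Type u) (Ω : Type v) [Field k] [Field Ω]
    [Algebra k Ω] [IsAlgClosed Ω] [IsGalois k Ω]
    (h : ∀ n : ℕ, ∃ f : k[X], Irreducible f ∧ n < f.natDegree) : Infinite (Ω ≃ₐ[k] Ω) := by
  by_contra hinf
  rw [not_infinite_iff_finite] at hinf
  exact not_finiteDimensional_of_irreducible_unbounded k Ω h (finiteDimensional_of_finite_algEquiv k Ω)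

/-! ### `ℚ_p` has irreducible polynomials of every prime degree -/

/-- `p ∈ ℚ_p` is not an `ℓ`-th power for `ℓ ≥ 2`: its valuation is `1` (so `X ^ ℓ − p` is an Eisenstein
polynomial). [cite: Gouvea1993PadicNumbers, Prop 6.3.11] -/
theorem Padic.natCast_ne_pow (p : ℕ) [Fact p.Prime] {ℓ : ℕ} (hℓ : 2 ≤ ℓ) (b : ℚ_[p]) :
    b ^ ℓ ≠ (p : ℚ_[p]) := by
  intro h
  have hb : b ≠ 0 := by
    rintro rfl
    rw [zero_pow (by omega)] at h
    exact (Nat.cast_ne_zero.mpr (Fact.out : p.Prime).ne_zero) h.symm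
  have hv := congrArg Padic.valuation h
  rw [Padic.valuation_pow, Padic.valuation_p] at hv
  -- `ℓ * v(b) = 1` is impossible for `ℓ ≥ 2`
  have hdvd : (ℓ : ℤ) ∣ 1 := Dvd.intro _ hv
  have h1 : (ℓ : ℤ) = 1 := Int.eq_one_of_dvd_one (Int.natCast_nonneg ℓ) hdvd
  omega

/-- **`X ^ ℓ − p` is irreducible over `ℚ_p` for every prime `ℓ`** — a special case of the Eisenstein
irreducibility criterion over `ℚ_p` (Gouvêa, Prop. 6.3.11: `|a_n| = 1`, `|a_i| < 1` for `i < n`,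
`|a_0| = 1/p`); proved here via Mathlib's prime-degree Kummer criterion instead of Gauss's lemma.
[cite: Gouvea1993PadicNumbers, Prop 6.3.11] -/
theorem Padic.irreducible_X_pow_sub_C_natCast (p : ℕ) [Fact p.Prime] {ℓ : ℕ} (hℓ : ℓ.Prime) :
    Irreducible (X ^ ℓ - C (p : ℚ_[p])) :=
  X_pow_sub_C_irreducible_of_prime hℓ fun b => Padic.natCast_ne_pow p hℓ.two_le b

/-- `ℚ_p` has irreducible polynomials of arbitrarily large degree (Gouvêa's Cor. 6.3.9 gives one of EVERY
degree via unramified lifts; the Eisenstein polynomials `X ^ ℓ − p`, `ℓ` prime, suffice here).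
[cite: Gouvea1993PadicNumbers, Cor 6.3.9] -/
theorem Padic.exists_irreducible_natDegree_gt (p : ℕ) [Fact p.Prime] (n : ℕ) :
    ∃ f : ℚ_[p][X], Irreducible f ∧ n < f.natDegree := by
  obtain ⟨ℓ, hnℓ, hℓ⟩ := Nat.exists_infinite_primes (n + 1)
  refine ⟨X ^ ℓ - C (p : ℚ_[p]), Padic.irreducible_X_pow_sub_C_natCast p hℓ, ?_⟩
  rw [Polynomial.natDegree_X_pow_sub_C]
  omega

/-! ### `ℚ̄_p / ℚ_p` is infinite; `G_{ℚ_p}` is infinite -/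

/-- **Gouvêa, Cor. 6.3.10: "The algebraic closure `ℚ̄_p` is an infinite extension of `ℚ_p`."**
[cite: Gouvea1993PadicNumbers, Cor 6.3.10] -/
theorem Padic.not_finiteDimensional_algebraicClosure (p : ℕ) [Fact p.Prime] :
    ¬ FiniteDimensional ℚ_[p] (AlgebraicClosure ℚ_[p]) :=
  not_finiteDimensional_of_irreducible_unbounded ℚ_[p] (AlgebraicClosure ℚ_[p])
    (Padic.exists_irreducible_natDegree_gt p)

/-- `ℚ̄_p / ℚ_p` is Galois (characteristic zero, algebraic closure). [cite: MilneFT2022, Prop 7.9] -/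
theorem Padic.isGalois_algebraicClosure (p : ℕ) [Fact p.Prime] :
    IsGalois ℚ_[p] (AlgebraicClosure ℚ_[p]) := {}

/-- **The absolute Galois group `G_{ℚ_p} = Gal(ℚ̄_p/ℚ_p)` is infinite** (Gouvêa Cor. 6.3.10 + the
Galois correspondence, Milne Thm. 7.13 (b)). [cite: Gouvea1993PadicNumbers, Cor 6.3.10] -/
theorem Padic.infinite_algEquiv_algebraicClosure (p : ℕ) [Fact p.Prime] :
    Infinite (AlgebraicClosure ℚ_[p] ≃ₐ[ℚ_[p]] AlgebraicClosure ℚ_[p]) := by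
  haveI := Padic.isGalois_algebraicClosure p
  exact infinite_algEquiv_of_irreducible_unbounded ℚ_[p] (AlgebraicClosure ℚ_[p])
    (Padic.exists_irreducible_natDegree_gt p)

/-! ### Open subgroups of infinite compact groups -/

/-- An open subgroup of an infinite compact Hausdorff topological group is infinite ("as `G` is compact,
each open `U` has finite index", Milne Ch. 7 p. 102): otherwise `{1}` is open in it, hence in the group,
which is then discrete and compact, hence finite. [cite: MilneFT2022, Ch 7 p.102] -/
theorem Subgroup.infinite_of_isOpen_of_compactSpace {G : Type u} [Group G] [TopologicalSpace G]
    [IsTopologicalGroup G] [T2Space G] [CompactSpace G] [Infinite G] (H : Subgroup G)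
    (hH : IsOpen (H : Set G)) : Infinite H := by
  by_contra hfin
  rw [not_infinite_iff_finite] at hfin
  -- `{1}` is open in the (finite, Hausdorff, hence discrete) subspace `H`, which is open in `G`
  have h1 : IsOpen ({1} : Set G) := by
    have : ({1} : Set G) = Subtype.val '' ({1} : Set H) := by
      rw [Set.image_singleton]; rfl
    rw [this]
    exact hH.isOpenMap_subtype_val _ (isOpen_discrete _)
  haveI : DiscreteTopology G := discreteTopology_iff_isOpen_singleton_one.mpr h1
  haveI : Finite G := finite_of_compact_of_discrete
  exact _root_.not_finite G

/-! ### `G_K` is infinite for every finite extension `K/ℚ_p` inside `ℚ̄_p` -/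

/-- **`G_K = Gal(ℚ̄_p/K)` is infinite** for every intermediate field `ℚ_p ⊆ K ⊆ ℚ̄_p` finite over `ℚ_p`
(`G_K = K.fixingSubgroup` is open — Milne Thm. 7.13 (b) — in the compact infinite group `G_{ℚ_p}`).
[cite: Gouvea1993PadicNumbers, Cor 6.3.10] -/
theorem Padic.infinite_fixingSubgroup (p : ℕ) [Fact p.Prime]
    (K : IntermediateField ℚ_[p] (AlgebraicClosure ℚ_[p])) [FiniteDimensional ℚ_[p] K] :
    Infinite K.fixingSubgroup := by
  haveI := Padic.isGalois_algebraicClosure p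
  haveI := Padic.infinite_algEquiv_algebraicClosure p
  exact Subgroup.infinite_of_isOpen_of_compactSpace K.fixingSubgroup K.fixingSubgroup_isOpen

/-- `G_K = K.fixingSubgroup` is compact (a closed subgroup of the profinite group `G_{ℚ_p}`, Milne
Thm. 7.13). [cite: MilneFT2022, Thm 7.13] -/
theorem Padic.compactSpace_fixingSubgroup (p : ℕ) [Fact p.Prime]
    (K : IntermediateField ℚ_[p] (AlgebraicClosure ℚ_[p])) : CompactSpace K.fixingSubgroup := by
  haveI := Padic.isGalois_algebraicClosure p
  exact isCompact_iff_compactSpace.mp (InfiniteGalois.fixingSubgroup_isClosed K).isCompact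

/-- The same with the ambient group written `Gal(ℚ̄_p/K) = ℚ̄_p ≃ₐ[K] ℚ̄_p` (`G_K ↪ Gal(ℚ̄_p/K)`).
[cite: Gouvea1993PadicNumbers, Cor 6.3.10] -/
theorem Padic.infinite_algEquiv_algebraicClosure_over (p : ℕ) [Fact p.Prime]
    (K : IntermediateField ℚ_[p] (AlgebraicClosure ℚ_[p])) [FiniteDimensional ℚ_[p] K] :
    Infinite (AlgebraicClosure ℚ_[p] ≃ₐ[K] AlgebraicClosure ℚ_[p]) := by
  haveI := Padic.infinite_fixingSubgroup p K
  exact Infinite.of_injective (fun σ : K.fixingSubgroup =>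
      ({ (σ : AlgebraicClosure ℚ_[p] ≃ₐ[ℚ_[p]] AlgebraicClosure ℚ_[p]) with
        commutes' := fun x => (IntermediateField.mem_fixingSubgroup_iff K _).mp σ.2 x x.2 } :
        AlgebraicClosure ℚ_[p] ≃ₐ[K] AlgebraicClosure ℚ_[p]))
    fun σ τ h => Subtype.ext (AlgEquiv.ext fun x => AlgEquiv.congr_fun h x)

end Literature.NumberTheory.LocalFields
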